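import Summits.QuantumFields.BalabanUV.T4Continuum.Spine.NE3.FrameNormalisationOneLevel
import HarnessLib

/-!
# T⁴ programme, node NE3 — census R50 open half (M1), THIRTEENTH BRICK: the SIZE of the twisted accumulated frame — `‖𝔳_k(z) − 1‖ ≤ Σ_{j<k} σ_j` when every twisted block frame is a
# unit of norm `≤ 1` within `σ_j` of `1` (the twisted analogue of [Balaban1985Averaging] (160)–(163)) (`FrameNormalisationTowerSize`)

Cell `pub-balaban-gaps` (track G2, seat ne3, generation 11), row NE3; census `HOME/ne/NE3.md` §4 R50, §17 (M1).  Sibling of `FrameNormalisationTowerError` (brick 10, `𝔳_k` vs `v_k(U′)`):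
here `𝔳_k` vs `1`.  In the twisted tower (`FrameNormalisationTower` ∕ `…TowerExists`) `𝔳₀ = 1`, `𝔳_{j+1}(z) = 𝔳_j(Lz)·w′ʲ(Lz)`; for `U1`-valued (e.g. unitary) frames a product of
near-identity units is near the identity additively (`B8Lemma1NonAbelian.norm_units_mul_sub_one_le`):

* **`norm_twistedVcov_sub_one_le`** — `𝔳_j(y) ∈ U1` and `‖w′ʲ(y) − 1‖ ≤ σ_j` for all `j, y` ⟹ `‖𝔳_k(z) − 1‖ ≤ Σ_{j<k} σ_j` — the size letter of the top datum `u₀,k⁻¹·𝔳_k` of the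
  (M1) fixed-point map (census §17 recipe (ii): the self-map radius), with `σ_j ≤ (e^{32dL^jb}-type plain frame size, (162)) + (twist letter ε_j of bricks 2∕8)`.

HONEST FRAMING (page 1).  Elementary bookkeeping (0 def, 0 sorry); nothing of Bałaban's asserted; **NE3 NOT proved**; `PairLandauGaugeB8Avg` and the covariant root NOT proved; spine PROVED
0∕9; finite T⁴ rung (B)+1 — NOT continuum YM on ℝ⁴, NOT infinite volume, NOT mass gap, NOT `BetaPertH`, NOT Clay.  HONEST DEPENDENCY: continuum YM on T⁴ ⇐ BetaPertH ∧ nine spine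
estimates (0/9 proved); BetaPertH ⇐ (D1) ∧ (D4) ∧ CAP+tail; G-an2-4 gates asym, D1 and NE2/3/4.  PLACEMENT: `Summits/QuantumFields/BalabanUV/T4Continuum/Spine/NE3/`; imports
`FrameNormalisationOneLevel` only.

References: [Balaban1985Averaging] T. Bałaban, *Averaging operations for lattice gauge theories*, CMP 98 (1985) 17–51: (97) p. 32, (160)–(163) p. 42.
-/

set_option autoImplicit false

open scoped BigOperators Matrix Matrix.Norms.L2Operator
open NormedSpace

namespace Summit.QuantumFields.BalabanUV.T4Continuum.NE3.FrameNormalisationTowerSize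

open Literature.MathematicalPhysics.QuantumFieldTheory.Balaban1983to89
open B7Prop1Explicit B7Prop2Explicit

noncomputable section

variable {d : ℕ} {n : Type*} [Fintype n] [DecidableEq n]

/-- **THE TWISTED ACCUMULATED FRAME IS WITHIN `Σ_{j<k} σ_j` OF `1`** (`𝔳₀ = 1`, `𝔳_{j+1}(z) = 𝔳_j(Lz)·w′ʲ(Lz)`, `𝔳_j(y) ∈ U1`, `‖w′ʲ(y) − 1‖ ≤ σ_j`). [folklore] -/
theorem norm_twistedVcov_sub_one_le [Nonempty n] (L : ℕ) (w' 𝔳 : ℕ → Site d → (Matrix n n ℂ)ˣ) (σ : ℕ → ℝ)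
    (h𝔳0 : ∀ z : Site d, 𝔳 0 z = 1) (h𝔳 : ∀ (j : ℕ) (z : Site d), 𝔳 (j + 1) z = 𝔳 j ((L : ℤ) • z) * w' j ((L : ℤ) • z))
    (hU1 : ∀ (j : ℕ) (y : Site d), 𝔳 j y ∈ U1 (Matrix n n ℂ))
    (hσ : ∀ (j : ℕ) (y : Site d), ‖((w' j y : (Matrix n n ℂ)ˣ) : Matrix n n ℂ) - 1‖ ≤ σ j) :
    ∀ (k : ℕ) (z : Site d), ‖((𝔳 k z : (Matrix n n ℂ)ˣ) : Matrix n n ℂ) - 1‖ ≤ ∑ j ∈ Finset.range k, σ j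
  | 0, z => by simp [h𝔳0 z]
  | k + 1, z => by
    rw [h𝔳, Finset.sum_range_succ]
    exact (B8Lemma1NonAbelian.norm_units_mul_sub_one_le (hU1 k _)).trans
      (add_le_add (norm_twistedVcov_sub_one_le L w' 𝔳 σ h𝔳0 h𝔳 hU1 hσ k _) (hσ k _))

/-- The `U1`-membership of the twisted accumulated frame PROPAGATES from that of the twisted block frames (so `hU1` above follows from `w′ʲ(y) ∈ U1`, e.g. unitary frames). [folklore] -/
theorem twistedVcov_mem_U1 [Nonempty n] (L : ℕ) (w' 𝔳 : ℕ → Site d → (Matrix n n ℂ)ˣ)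
    (h𝔳0 : ∀ z : Site d, 𝔳 0 z = 1) (h𝔳 : ∀ (j : ℕ) (z : Site d), 𝔳 (j + 1) z = 𝔳 j ((L : ℤ) • z) * w' j ((L : ℤ) • z))
    (hw : ∀ (j : ℕ) (y : Site d), w' j y ∈ U1 (Matrix n n ℂ)) :
    ∀ (k : ℕ) (z : Site d), 𝔳 k z ∈ U1 (Matrix n n ℂ)
  | 0, z => by rw [h𝔳0 z]; exact (U1 _).one_mem
  | k + 1, z => by
    rw [h𝔳]
    exact (U1 _).mul_mem (twistedVcov_mem_U1 L w' 𝔳 h𝔳0 h𝔳 hw k _) (hw k _)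

end

end Summit.QuantumFields.BalabanUV.T4Continuum.NE3.FrameNormalisationTowerSize
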